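import Literature.NumberTheory.Automorphic.HyperspecialUnitaryRankOneNotSquareIntegrable
import Literature.NumberTheory.Automorphic.UnitaryRankOneBasicHeckeOperator
import Summits.HodgeConjecture.HodgeConjecture.Theorems.K2LiuCartanFamilyInert

/-!
# The hyperspecial Hecke cells of the unramified `U(1,1)`: the three Iwasawa cells of `K₀ t K₀ ∕ K₀`, `t = diag(ϖ, ϖ⁻¹)`,
# `K₀ = U(σ, J₀) ∩ GL₂(𝒪)` (LOCAL SEAM of s23, inert package, organ (26-n) H2, part A)

Track B ∕ K2-LIT, hLiu418 = stmt-HodgeConjecture-24832; inert package of the local seam of s23 (words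
`K2/K2Liu-p01/g3/INERT-SOCKETS-v2.K2Liup01g3.md`, plan `PLAN-28i-row26.K2Liup01g3.md`). Helper (count-neutral, own head per LEAD R3):
the `N = 2` TWIN of ★ (L1) `HyperspecialUnitaryRankOneHeckeNeighbours` §1–§7 over the abstract datum ★ `UnramifiedLocalConjDatum σ ϖ` (`K` a valued
field, `σ` an involution preserving `v`, `σ`-fixed uniformiser `ϖ`). `G = U(σ, J₀)(K)`, `J₀ = antidiag(1,1)`; `K₀ = unitaryInt` (hyperspecial);
`K_P = hd.borelLatticeU ⊓ K₀ = N(𝒪) = {u(β) : β + σβ = 0, v β ≤ 1}` (★ `mem_borelInt_iff_two`); the generator is ANY `t ∈ G` with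
`(t : GL₂) = diag(ϖ, ϖ⁻¹) = zpowDiagGL (1,−1)` (binder `ht`; this is ★ p857060's `Ψ(t₁)` and the `t` of ★ `coe_mem_orbit_basic_iff_two`). Then:
* §1 powers and inverse of `t`; §2 `t K_P t⁻¹ ≤ K_P` (★ `conjAct_smul_inf_le_of_antitone_unitary`); §3 the shells `K₀ tᵐ K₀` are pairwise
  disjoint (★ `eq_of_unitaryInt_mul_zpowDiagGL_mul_eq_of_antitone`) and `t⁻¹ ∈ K₀ t K₀` (★ `inv_mem_doubleCoset_unitaryInt`); §4 the entries of
  `K₀ t K₀` have `v ≤ v(ϖ⁻¹)`;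
* §5 the level-zero neighbours `u(β) K₀`, `v β = v(ϖ⁻¹)` (★ `coe_mem_orbit_basic_iff_two`, ★ `mem_unitaryInt_iff_of_unitriangular_two`):
  coset criterion `u(β)K₀ = u(β′)K₀ ↔ v(β′ − β) ≤ 1`, and `t u(β) t⁻¹ ∈ K_P` for `v β ≤ v(ϖ⁻²)` (★ `mem_conjAct_borelInt_iff_two`);
* §6 **EXHAUSTION** `exists_rep_of_mem_doubleCoset_two`: every `gK₀ ⊆ K₀tK₀` is `u t K₀` (`u ∈ K_P`), `u(β)K₀` (`v β = v(ϖ⁻¹)`) or `t⁻¹K₀` — Iwasawa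
  `g = u·diag(ϖ^a)·k` (★ `exists_eq_unipotent_mul_zpowDiagGL_mul_unitaryInt`), the §4 bound (`a₀ ∈ {1, 0, −1}`), and in the bottom cell
  `u t⁻¹ K₀ = t⁻¹ (t u t⁻¹) K₀ = t⁻¹ K₀` since `v β ≤ v(ϖ⁻²)`;
* §7 the cells are told apart by their Iwasawa exponents `(1,−1), 0, (−1,1)`; `u t K₀ = u′ t K₀ ↔ u⁻¹u′ ∈ tK_Pt⁻¹`.
The transversal, the counts and the package for ★ `K2LiuHeckeShellRecursion` (p857139) are part B `K2LiuRankOneHeckeNeighboursTwo`.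
[BruhatTits1972, (4.4.3)–(4.4.4)]; [Tits1979, §3.3.3]; [SerreTrees1980, II.1.1]; [Rogawski1990, §1.10]. Theorems only; no `sorry`; no definition
(`t` is a binder). HONEST LABEL: HC_CM is proved only modulo the printed citations (2 remaining named inputs: hLiu418 = stmt-HodgeConjecture-24832,
h413 = stmt-HodgeConjecture-24833) until rung 0 closes; this file is unconditional and moves no counter.
-/

set_option autoImplicit false

set_option linter.dupNamespace false

noncomputable section

open scoped Valued WithZero Matrix MatrixGroups Pointwise
open MulAction ConjAct

namespace Summit.HodgeConjecture.HodgeConjecture.Cruxes.HLiu418.K2LiuRankOneHeckeCellsTwo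

open Literature.NumberTheory.Automorphic Literature.NumberTheory.Automorphic.HermitianLattice
open Literature.NumberTheory.Automorphic.CartanUnique Literature.NumberTheory.Automorphic.SymplecticCartan
open Literature.NumberTheory.Automorphic.HermitianLattice.UnramifiedLocalConjDatum
open Summit.HodgeConjecture.HodgeConjecture.Cruxes.HLiu418.K2LiuCartanFamilyInert (antitone_rev_vec)

variable {K : Type*} [Field K] [Valued K ℤᵐ⁰] {σ : K →+* K} {ϖ : K}

/-! ## §1 The generator `t = diag(ϖ, ϖ⁻¹)` -/

/-- `(1, −1)` is `rev`-antisymmetric. [cite: BruhatTits1972, (4.4.3)] -/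
theorem rev_vecOne (i : Fin 2) : (![(1 : ℤ), -1] : Fin 2 → ℤ) (Fin.rev i) = -(![(1 : ℤ), -1] : Fin 2 → ℤ) i := by
  fin_cases i <;> rfl

/-- `(1, −1)` is antitone (dominant). [cite: BruhatTits1972, (4.4.3)] -/
theorem antitone_vecOne : Antitone (![(1 : ℤ), -1] : Fin 2 → ℤ) := by
  intro i j hij
  fin_cases i <;> fin_cases j <;> first | decide | exact absurd hij (by decide)

/-- `t` as the normalised torus element `⟨diag(ϖ^{(1,−1)}), _⟩`. [cite: BruhatTits1972, (4.4.3)] -/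
theorem eq_mk_of_coe_eq (hd : UnramifiedLocalConjDatum σ ϖ) {t : unitaryGroupOfForm σ ((StdForm.antidiagonal 2).over K)}
    (ht : (t : GL (Fin 2) K) = zpowDiagGL (uniformizer_ne_zero hd.vϖ) ![(1 : ℤ), -1]) :
    t = ⟨zpowDiagGL (uniformizer_ne_zero hd.vϖ) ![(1 : ℤ), -1], zpowDiagGL_mem_unitaryGroupOfForm hd.σϖ _ rev_vecOne⟩ :=
  Subtype.ext ht

/-- `t` is the `t = diag(ϖ^{ℓ₁})`, `ℓ₁ = (1·(1−2i))_i`, of ★ `coe_mem_orbit_basic_iff_two`. [cite: BruhatTits1972, (4.4.3)] -/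
theorem eq_basic_of_coe_eq (hd : UnramifiedLocalConjDatum σ ϖ) {t : unitaryGroupOfForm σ ((StdForm.antidiagonal 2).over K)}
    (ht : (t : GL (Fin 2) K) = zpowDiagGL (uniformizer_ne_zero hd.vϖ) ![(1 : ℤ), -1]) :
    t = ⟨zpowDiagGL (uniformizer_ne_zero hd.vϖ) (fun i : Fin 2 => (1 : ℤ) * (1 - 2 * (i : ℕ))),
      zpowDiagGL_mem_unitaryGroupOfForm hd.σϖ _ (rev_linear_two 1)⟩ := by
  refine Subtype.ext (ht.trans (congrArg _ (funext fun i => ?_)))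
  fin_cases i <;> simp

/-- Powers of `t`: `(tᵐ : GL₂) = diag(ϖ^{(m,−m)})`. [cite: BruhatTits1972, (4.4.3)] -/
theorem coe_pow_of_coe_eq (hd : UnramifiedLocalConjDatum σ ϖ) {t : unitaryGroupOfForm σ ((StdForm.antidiagonal 2).over K)}
    (ht : (t : GL (Fin 2) K) = zpowDiagGL (uniformizer_ne_zero hd.vϖ) ![(1 : ℤ), -1]) (m : ℕ) :
    ((t ^ m : unitaryGroupOfForm σ ((StdForm.antidiagonal 2).over K)) : GL (Fin 2) K) =
      zpowDiagGL (uniformizer_ne_zero hd.vϖ) ![(m : ℤ), -(m : ℤ)] := by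
  induction m with
  | zero =>
    rw [pow_zero, OneMemClass.coe_one, ← zpowDiagGL_zero (uniformizer_ne_zero hd.vϖ)]
    congr 1; funext i; fin_cases i <;> simp
  | succ k ih =>
    rw [pow_succ, Subgroup.coe_mul, ih, ht, ← zpowDiagGL_add]
    congr 1; funext i; fin_cases i
    · simp
    · simp; ring

/-- `tᵐ` as the normalised torus representative of its shell. [cite: BruhatTits1972, (4.4.3)] -/
theorem pow_eq_mk_of_coe_eq (hd : UnramifiedLocalConjDatum σ ϖ) {t : unitaryGroupOfForm σ ((StdForm.antidiagonal 2).over K)}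
    (ht : (t : GL (Fin 2) K) = zpowDiagGL (uniformizer_ne_zero hd.vϖ) ![(1 : ℤ), -1]) (m : ℕ) :
    t ^ m = ⟨zpowDiagGL (uniformizer_ne_zero hd.vϖ) ![(m : ℤ), -(m : ℤ)], zpowDiagGL_mem_unitaryGroupOfForm hd.σϖ _ (antitone_rev_vec m).2⟩ :=
  Subtype.ext (coe_pow_of_coe_eq hd ht m)

/-- The inverse: `(t⁻¹ : GL₂) = diag(ϖ^{−(1,−1)})`. [cite: BruhatTits1972, (4.4.3)] -/
theorem coe_inv_of_coe_eq (hd : UnramifiedLocalConjDatum σ ϖ) {t : unitaryGroupOfForm σ ((StdForm.antidiagonal 2).over K)}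
    (ht : (t : GL (Fin 2) K) = zpowDiagGL (uniformizer_ne_zero hd.vϖ) ![(1 : ℤ), -1]) :
    ((t⁻¹ : unitaryGroupOfForm σ ((StdForm.antidiagonal 2).over K)) : GL (Fin 2) K) = zpowDiagGL (uniformizer_ne_zero hd.vϖ) (-![(1 : ℤ), -1]) := by
  rw [Subgroup.coe_inv, ht, zpowDiagGL_neg]

/-- `t⁻¹` as a normalised torus element. [cite: BruhatTits1972, (4.4.3)] -/
theorem inv_eq_mk_of_coe_eq (hd : UnramifiedLocalConjDatum σ ϖ) {t : unitaryGroupOfForm σ ((StdForm.antidiagonal 2).over K)}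
    (ht : (t : GL (Fin 2) K) = zpowDiagGL (uniformizer_ne_zero hd.vϖ) ![(1 : ℤ), -1]) :
    t⁻¹ = ⟨zpowDiagGL (uniformizer_ne_zero hd.vϖ) (-![(1 : ℤ), -1]),
      zpowDiagGL_mem_unitaryGroupOfForm hd.σϖ _ (fun i => by rw [Pi.neg_apply, Pi.neg_apply, rev_vecOne])⟩ :=
  Subtype.ext (coe_inv_of_coe_eq hd ht)

/-! ## §2 `t` contracts `K_P = N(𝒪)` -/

/-- **`t K_P t⁻¹ ≤ K_P`** (★ `conjAct_smul_inf_le_of_antitone_unitary` at the dominant `(1,−1)`). [cite: BruhatTits1972, (4.4.4)]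
[cite: CartierCorvallis1979, §IV (4.2)] -/
theorem conj_mem_borelInt_two (hd : UnramifiedLocalConjDatum σ ϖ) {t : unitaryGroupOfForm σ ((StdForm.antidiagonal 2).over K)}
    (ht : (t : GL (Fin 2) K) = zpowDiagGL (uniformizer_ne_zero hd.vϖ) ![(1 : ℤ), -1])
    {u : unitaryGroupOfForm σ ((StdForm.antidiagonal 2).over K)} (hu : u ∈ hd.borelLatticeU ⊓ unitaryInt σ ((StdForm.antidiagonal 2).over K)) :
    t * u * t⁻¹ ∈ hd.borelLatticeU ⊓ unitaryInt σ ((StdForm.antidiagonal 2).over K) := by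
  have h := hd.conjAct_smul_inf_le_of_antitone_unitary antitone_vecOne rev_vecOne
  rw [← eq_mk_of_coe_eq hd ht] at h
  rw [← toConjAct_smul]
  exact h (Subgroup.smul_mem_pointwise_smul _ _ _ hu)

/-! ## §3 The Cartan shells `K₀ tᵐ K₀` are pairwise disjoint; `t⁻¹ ∈ K₀ t K₀` -/

/-- **The shells `K₀ tᵐ K₀` (`m ∈ ℕ`) are pairwise disjoint.** [cite: BruhatTits1972, (4.4.3)] [cite: Tits1979, §3.3.3] -/
theorem disjoint_doubleCoset_pow_two (hd : UnramifiedLocalConjDatum σ ϖ) {t : unitaryGroupOfForm σ ((StdForm.antidiagonal 2).over K)}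
    (ht : (t : GL (Fin 2) K) = zpowDiagGL (uniformizer_ne_zero hd.vϖ) ![(1 : ℤ), -1]) {m n : ℕ} (hmn : m ≠ n) :
    Disjoint (DoubleCoset.doubleCoset (t ^ m) (unitaryInt σ ((StdForm.antidiagonal 2).over K) : Set _)
        (unitaryInt σ ((StdForm.antidiagonal 2).over K)))
      (DoubleCoset.doubleCoset (t ^ n) (unitaryInt σ ((StdForm.antidiagonal 2).over K) : Set _)
        (unitaryInt σ ((StdForm.antidiagonal 2).over K))) := by
  by_contra h
  have hmem := DoubleCoset.mem_doubleCoset_of_not_disjoint h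
  obtain ⟨k₁, hk₁, k₂, hk₂, heq⟩ := DoubleCoset.mem_doubleCoset.1 hmem
  rw [pow_eq_mk_of_coe_eq hd ht m, pow_eq_mk_of_coe_eq hd ht n] at heq
  have hab := eq_of_unitaryInt_mul_zpowDiagGL_mul_eq_of_antitone hd.vϖ hd.σϖ (antitone_rev_vec m) (antitone_rev_vec n) hk₁ hk₂ heq.symm
  have h0 := congrFun hab 0
  simp only [Matrix.cons_val_zero, Nat.cast_inj] at h0
  exact hmn h0

/-- **`t⁻¹ ∈ K₀ t K₀`** (★ `inv_mem_doubleCoset_unitaryInt`). [cite: BruhatTits1972, (4.4.3)] -/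
theorem inv_mem_doubleCoset_two (hd : UnramifiedLocalConjDatum σ ϖ) (t : unitaryGroupOfForm σ ((StdForm.antidiagonal 2).over K)) :
    t⁻¹ ∈ DoubleCoset.doubleCoset t (unitaryInt σ ((StdForm.antidiagonal 2).over K) : Set _) (unitaryInt σ ((StdForm.antidiagonal 2).over K)) :=
  inv_mem_doubleCoset_unitaryInt hd t

/-! ## §4 Entries on the shell `K₀ t K₀` have valuation `≤ v(ϖ⁻¹)` -/

/-- **Every entry of `g ∈ K₀ t K₀` has valuation `≤ exp 1 = v(ϖ⁻¹)`.** [cite: BruhatTits1972, (4.4.3)] -/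
theorem v_apply_le_exp_one_of_mem_doubleCoset_two (hd : UnramifiedLocalConjDatum σ ϖ)
    {t : unitaryGroupOfForm σ ((StdForm.antidiagonal 2).over K)}
    (ht : (t : GL (Fin 2) K) = zpowDiagGL (uniformizer_ne_zero hd.vϖ) ![(1 : ℤ), -1])
    {g : unitaryGroupOfForm σ ((StdForm.antidiagonal 2).over K)}
    (hg : g ∈ DoubleCoset.doubleCoset t (unitaryInt σ ((StdForm.antidiagonal 2).over K) : Set _) (unitaryInt σ ((StdForm.antidiagonal 2).over K)))
    (i j : Fin 2) :
    Valued.v (((g : GL (Fin 2) K) : Matrix (Fin 2) (Fin 2) K) i j) ≤ WithZero.exp (1 : ℤ) := by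
  obtain ⟨k₁, hk₁, k₂, hk₂, rfl⟩ := DoubleCoset.mem_doubleCoset.1 hg
  have h1 := (mem_unitaryInt_iff.1 (hk₁ : k₁ ∈ unitaryInt σ _)).1
  have h2 := (mem_unitaryInt_iff.1 (hk₂ : k₂ ∈ unitaryInt σ _)).1
  rw [Subgroup.coe_mul, Subgroup.coe_mul, Units.val_mul, Units.val_mul, Matrix.mul_apply]
  refine Valuation.map_sum_le _ fun l _ => ?_
  rw [Matrix.mul_apply, Finset.sum_mul]
  refine Valuation.map_sum_le _ fun m _ => ?_
  rw [map_mul, map_mul, ht, coe_zpowDiagGL, Matrix.diagonal_apply]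
  split_ifs with hml
  · rw [v_uniformizer_zpow hd.vϖ]
    have hle : WithZero.exp (-(![(1 : ℤ), -1] : Fin 2 → ℤ) m) ≤ WithZero.exp (1 : ℤ) := by
      rw [WithZero.exp_le_exp]; fin_cases m <;> simp
    calc Valued.v (((k₁ : GL (Fin 2) K) : Matrix (Fin 2) (Fin 2) K) i m) * WithZero.exp (-(![(1 : ℤ), -1] : Fin 2 → ℤ) m) *
          Valued.v (((k₂ : GL (Fin 2) K) : Matrix (Fin 2) (Fin 2) K) l j)
        ≤ 1 * WithZero.exp (1 : ℤ) * 1 := mul_le_mul' (mul_le_mul' (h1 i m) hle) (hml ▸ h2 m j)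
      _ = WithZero.exp (1 : ℤ) := by rw [one_mul, mul_one]
  · rw [map_zero, mul_zero, zero_mul]; exact zero_le

/-- `g k⁻¹ ∈ K₀ t K₀` for `g ∈ K₀ t K₀`, `k ∈ K₀`. [cite: BruhatTits1972, (4.4.3)] -/
theorem mul_inv_mem_doubleCoset_two {t g k : unitaryGroupOfForm σ ((StdForm.antidiagonal 2).over K)}
    (hg : g ∈ DoubleCoset.doubleCoset t (unitaryInt σ ((StdForm.antidiagonal 2).over K) : Set _) (unitaryInt σ ((StdForm.antidiagonal 2).over K)))
    (hk : k ∈ unitaryInt σ ((StdForm.antidiagonal 2).over K)) :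
    g * k⁻¹ ∈ DoubleCoset.doubleCoset t (unitaryInt σ ((StdForm.antidiagonal 2).over K) : Set _) (unitaryInt σ ((StdForm.antidiagonal 2).over K)) := by
  obtain ⟨k₁, hk₁, k₂, hk₂, rfl⟩ := DoubleCoset.mem_doubleCoset.1 hg
  exact DoubleCoset.mem_doubleCoset.2 ⟨k₁, hk₁, k₂ * k⁻¹, (unitaryInt σ _).mul_mem hk₂ ((unitaryInt σ _).inv_mem hk), by rw [mul_assoc]⟩

/-! ## §5 The level-zero neighbours `u(β)`, `β + σβ = 0`, `v β = v(ϖ⁻¹)` -/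

omit [Valued K ℤᵐ⁰] in
/-- `u⁻¹ u'` is upper unitriangular for `u, u'` upper unitriangular. [folklore] -/
theorem inv_mul_mem_upperUnitriangular_two {u u' : unitaryGroupOfForm σ ((StdForm.antidiagonal 2).over K)}
    (hu : (u : GL (Fin 2) K) ∈ upperUnitriangular (Fin 2) K) (hu' : (u' : GL (Fin 2) K) ∈ upperUnitriangular (Fin 2) K) :
    ((u⁻¹ * u' : unitaryGroupOfForm σ ((StdForm.antidiagonal 2).over K)) : GL (Fin 2) K) ∈ upperUnitriangular (Fin 2) K := by
  rw [Subgroup.coe_mul, Subgroup.coe_inv]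
  exact (upperUnitriangular (Fin 2) K).mul_mem ((upperUnitriangular (Fin 2) K).inv_mem hu) hu'

/-- **Two level-zero neighbours `u(β) K₀ = u(β′) K₀` iff `v(β′ − β) ≤ 1`** (`(u(β)⁻¹u(β′))₀₁ = β′ + σβ = β′ − β`, ★ `inv_mul_apply_zero_one_two`,
★ `mem_unitaryInt_iff_of_unitriangular_two`). [cite: BruhatTits1972, (4.4.4)] [cite: Rogawski1990, §1.10 p. 14] -/
theorem unip_coe_eq_iff (hd : UnramifiedLocalConjDatum σ ϖ) {u u' : unitaryGroupOfForm σ ((StdForm.antidiagonal 2).over K)}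
    (hu : (u : GL (Fin 2) K) ∈ upperUnitriangular (Fin 2) K) (hu' : (u' : GL (Fin 2) K) ∈ upperUnitriangular (Fin 2) K) :
    ((u : unitaryGroupOfForm σ ((StdForm.antidiagonal 2).over K)) :
        unitaryGroupOfForm σ ((StdForm.antidiagonal 2).over K) ⧸ unitaryInt σ ((StdForm.antidiagonal 2).over K)) = ↑u' ↔
      Valued.v (((u' : GL (Fin 2) K) : Matrix (Fin 2) (Fin 2) K) 0 1 - ((u : GL (Fin 2) K) : Matrix (Fin 2) (Fin 2) K) 0 1) ≤ 1 := by
  have hσβ : σ (((u : GL (Fin 2) K) : Matrix (Fin 2) (Fin 2) K) 0 1) = -((u : GL (Fin 2) K) : Matrix (Fin 2) (Fin 2) K) 0 1 := by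
    have := apply_add_map_apply_eq_two hu; linear_combination this
  rw [QuotientGroup.eq, hd.mem_unitaryInt_iff_of_unitriangular_two (inv_mul_mem_upperUnitriangular_two hu hu'),
    inv_mul_apply_zero_one_two hu hu', hσβ, ← sub_eq_add_neg]

/-- **A level-zero neighbour lies on the shell**: `u(β) ∈ K₀ t K₀` for `v β = v(ϖ⁻¹)` (★ `coe_mem_orbit_basic_iff_two`).
[cite: BruhatTits1972, (4.4.3), (4.4.4)] -/
theorem unip_mem_doubleCoset_two (hd : UnramifiedLocalConjDatum σ ϖ) {t : unitaryGroupOfForm σ ((StdForm.antidiagonal 2).over K)}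
    (ht : (t : GL (Fin 2) K) = zpowDiagGL (uniformizer_ne_zero hd.vϖ) ![(1 : ℤ), -1])
    {u : unitaryGroupOfForm σ ((StdForm.antidiagonal 2).over K)} (hu : (u : GL (Fin 2) K) ∈ upperUnitriangular (Fin 2) K)
    (hβ : Valued.v (((u : GL (Fin 2) K) : Matrix (Fin 2) (Fin 2) K) 0 1) = WithZero.exp (1 : ℤ)) :
    u ∈ DoubleCoset.doubleCoset t (unitaryInt σ ((StdForm.antidiagonal 2).over K) : Set _) (unitaryInt σ ((StdForm.antidiagonal 2).over K)) := by
  have h := (hd.coe_mem_orbit_basic_iff_two hu).2 ⟨hβ.le, fun h1 => by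
    rw [hβ, ← WithZero.exp_zero, WithZero.exp_le_exp] at h1; norm_num at h1⟩
  rw [← eq_basic_of_coe_eq hd ht] at h
  obtain ⟨a, ha, b, hb, hab⟩ := (heckeAlgebra.coe_mem_orbit_coe_iff (unitaryInt σ ((StdForm.antidiagonal 2).over K)) _ u).1 h
  exact DoubleCoset.mem_doubleCoset.2 ⟨a, ha, b, hb, hab⟩

/-- **`t u(β) t⁻¹ = u(ϖ²β) ∈ K_P` when `v β ≤ v(ϖ⁻²)`** (★ `mem_conjAct_borelInt_iff_two` at `t⁻¹ = diag(ϖ^{(−1,1)})`), in particular for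
the level-zero neighbours. [cite: BruhatTits1972, (4.4.4)] -/
theorem conj_unip_mem_borelInt_two (hd : UnramifiedLocalConjDatum σ ϖ) {t : unitaryGroupOfForm σ ((StdForm.antidiagonal 2).over K)}
    (ht : (t : GL (Fin 2) K) = zpowDiagGL (uniformizer_ne_zero hd.vϖ) ![(1 : ℤ), -1])
    {u : unitaryGroupOfForm σ ((StdForm.antidiagonal 2).over K)} (hu : (u : GL (Fin 2) K) ∈ upperUnitriangular (Fin 2) K)
    (hβ : Valued.v (((u : GL (Fin 2) K) : Matrix (Fin 2) (Fin 2) K) 0 1) ≤ WithZero.exp (2 : ℤ)) :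
    t * u * t⁻¹ ∈ hd.borelLatticeU ⊓ unitaryInt σ ((StdForm.antidiagonal 2).over K) := by
  have hneg : ∀ i, (-![(1 : ℤ), -1] : Fin 2 → ℤ) (Fin.rev i) = -(-![(1 : ℤ), -1] : Fin 2 → ℤ) i := fun i => by
    rw [Pi.neg_apply, Pi.neg_apply, rev_vecOne]
  have h := (hd.mem_conjAct_borelInt_iff_two hneg (g := u)).2 ⟨hu, by
    simpa using hβ⟩
  rw [← inv_eq_mk_of_coe_eq hd ht, Subgroup.mem_pointwise_smul_iff_inv_smul_mem, ← toConjAct_inv, inv_inv, toConjAct_smul] at h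
  exact h

/-! ## §6 EXHAUSTION: every coset of `K₀ t K₀ ∕ K₀` is `u t K₀` (`u ∈ K_P`), `u(β) K₀` (`v β = v(ϖ⁻¹)`) or `t⁻¹ K₀` -/

/-- **EXHAUSTION OF `K₀ t K₀ ∕ K₀` BY THE THREE IWASAWA CELLS** (`N = 2`).  Let `g ∈ K₀ t K₀`, `g = u · diag(ϖ^a) · k` (Iwasawa, `a = (a₀, −a₀)`).
The entries of `u diag(ϖ^a) = g k⁻¹` have `v ≤ v(ϖ⁻¹)` (§4), whence `a₀ ∈ {1, 0, −1}` and, with `β = u₀₁`: (`a₀ = 1`) `v(β ϖ⁻¹) ≤ v(ϖ⁻¹)` so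
`u ∈ K_P` and `gK₀ = u t K₀`; (`a₀ = 0`) `v β ≤ v(ϖ⁻¹)` and `v β > 1` (else `g ∈ K₀ ∩ K₀tK₀ = ∅`), so `v β = v(ϖ⁻¹)` and `gK₀ = u(β)K₀`; (`a₀ = −1`)
`v(β ϖ) ≤ v(ϖ⁻¹)`, so `t u t⁻¹ ∈ K_P` and `gK₀ = u t⁻¹K₀ = t⁻¹(t u t⁻¹)K₀ = t⁻¹K₀`. [cite: BruhatTits1972, (4.4.4)] [cite: Tits1979, §3.3.3]
[cite: Rogawski1990, §1.10 p. 14] -/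
theorem exists_rep_of_mem_doubleCoset_two (hd : UnramifiedLocalConjDatum σ ϖ) {t : unitaryGroupOfForm σ ((StdForm.antidiagonal 2).over K)}
    (ht : (t : GL (Fin 2) K) = zpowDiagGL (uniformizer_ne_zero hd.vϖ) ![(1 : ℤ), -1])
    {g : unitaryGroupOfForm σ ((StdForm.antidiagonal 2).over K)}
    (hg : g ∈ DoubleCoset.doubleCoset t (unitaryInt σ ((StdForm.antidiagonal 2).over K) : Set _) (unitaryInt σ ((StdForm.antidiagonal 2).over K))) :
    (∃ u ∈ hd.borelLatticeU ⊓ unitaryInt σ ((StdForm.antidiagonal 2).over K),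
        (g : unitaryGroupOfForm σ ((StdForm.antidiagonal 2).over K) ⧸ unitaryInt σ ((StdForm.antidiagonal 2).over K)) = ↑(u * t)) ∨
    (∃ u : unitaryGroupOfForm σ ((StdForm.antidiagonal 2).over K), (u : GL (Fin 2) K) ∈ upperUnitriangular (Fin 2) K ∧
        Valued.v (((u : GL (Fin 2) K) : Matrix (Fin 2) (Fin 2) K) 0 1) = WithZero.exp (1 : ℤ) ∧
        (g : unitaryGroupOfForm σ ((StdForm.antidiagonal 2).over K) ⧸ unitaryInt σ ((StdForm.antidiagonal 2).over K)) = ↑u) ∨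
    (g : unitaryGroupOfForm σ ((StdForm.antidiagonal 2).over K) ⧸ unitaryInt σ ((StdForm.antidiagonal 2).over K)) = ↑t⁻¹ := by
  have hϖ0 := uniformizer_ne_zero hd.vϖ
  obtain ⟨u, d, k, a, hu, ha, hdcoe, hk, hgeq⟩ := hd.exists_eq_unipotent_mul_zpowDiagGL_mul_unitaryInt g
  have a1 : a 1 = -a 0 := by have h := ha 0; rwa [show Fin.rev (0 : Fin 2) = 1 from by decide] at h
  -- `g K₀ = u d K₀` and `u d ∈ K₀ t K₀`
  have hcoset : (g : unitaryGroupOfForm σ ((StdForm.antidiagonal 2).over K) ⧸ unitaryInt σ ((StdForm.antidiagonal 2).over K)) = ↑(u * d) := by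
    rw [QuotientGroup.eq, hgeq]
    simpa [mul_assoc] using (unitaryInt σ ((StdForm.antidiagonal 2).over K)).inv_mem hk
  have hud : u * d ∈ DoubleCoset.doubleCoset t (unitaryInt σ ((StdForm.antidiagonal 2).over K) : Set _)
      (unitaryInt σ ((StdForm.antidiagonal 2).over K)) := by
    have h := mul_inv_mem_doubleCoset_two hg hk
    rwa [hgeq, mul_assoc (u * d), mul_inv_cancel, mul_one] at h
  -- entries of `u d`
  have hent : ∀ i j, Valued.v (((u : GL (Fin 2) K) : Matrix (Fin 2) (Fin 2) K) i j * ϖ ^ a j) ≤ WithZero.exp (1 : ℤ) := by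
    intro i j
    have h := v_apply_le_exp_one_of_mem_doubleCoset_two hd ht hud i j
    rwa [Subgroup.coe_mul, Units.val_mul, hdcoe, coe_zpowDiagGL, Matrix.mul_diagonal] at h
  have hdiag := apply_self_of_mem_upperUnitriangular hu
  -- `-1 ≤ a₀ ≤ 1`
  have h00 : -a 0 ≤ 1 := by
    have h := hent 0 0
    rwa [hdiag, one_mul, v_uniformizer_zpow hd.vϖ, WithZero.exp_le_exp] at h
  have h11 : a 0 ≤ 1 := by
    have h := hent 1 1
    rwa [hdiag, one_mul, v_uniformizer_zpow hd.vϖ, a1, neg_neg, WithZero.exp_le_exp] at h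
  rcases (show a 0 = 1 ∨ a 0 = 0 ∨ a 0 = -1 by omega) with h1 | h0 | hm1
  · -- TOP CELL
    left
    have ha' : a = ![(1 : ℤ), -1] := by
      funext i; fin_cases i
      · exact h1
      · simp [a1, h1]
    have hdt : d = t := Subtype.ext (by rw [hdcoe, ha', ht])
    refine ⟨u, ?_, by rw [hcoset, hdt]⟩
    rw [hd.mem_borelInt_iff_two]
    refine ⟨hu, ?_⟩
    have h := hent 0 1
    rw [a1, h1] at h
    have h' := hd.v_le_exp_of_mul_zpow_le h
    rwa [show (1 : ℤ) + -1 = 0 by norm_num, WithZero.exp_zero] at h'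
  · -- MIDDLE CELL
    right; left
    have ha' : a = 0 := by
      funext i; fin_cases i
      · exact h0
      · simp [a1, h0]
    have hd1 : d = 1 := Subtype.ext (by rw [hdcoe, ha', zpowDiagGL_zero]; rfl)
    have hx1 : Valued.v (((u : GL (Fin 2) K) : Matrix (Fin 2) (Fin 2) K) 0 1) ≤ WithZero.exp (1 : ℤ) := by
      have h := hent 0 1; rwa [a1, h0, neg_zero, zpow_zero, mul_one] at h
    -- `v β = exp 1` (otherwise `u ∈ K₀` and `g ∈ K₀ ∩ K₀ t K₀ = ∅`)
    have hx : Valued.v (((u : GL (Fin 2) K) : Matrix (Fin 2) (Fin 2) K) 0 1) = WithZero.exp (1 : ℤ) := by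
      refine v_eq_exp_one_of_one_lt (lt_of_not_ge fun hle => ?_) hx1
      have huK : u ∈ unitaryInt σ ((StdForm.antidiagonal 2).over K) := (hd.mem_unitaryInt_iff_of_unitriangular_two hu).2 hle
      have hgK : g ∈ unitaryInt σ ((StdForm.antidiagonal 2).over K) := by
        rw [hgeq, hd1, mul_one]; exact (unitaryInt σ _).mul_mem huK hk
      have hg0 : g ∈ DoubleCoset.doubleCoset (t ^ 0) (unitaryInt σ ((StdForm.antidiagonal 2).over K) : Set _)
          (unitaryInt σ ((StdForm.antidiagonal 2).over K)) :=
        DoubleCoset.mem_doubleCoset.2 ⟨g, hgK, 1, (unitaryInt σ _).one_mem, by rw [pow_zero, mul_one, mul_one]⟩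
      have hg1 : g ∈ DoubleCoset.doubleCoset (t ^ 1) (unitaryInt σ ((StdForm.antidiagonal 2).over K) : Set _)
          (unitaryInt σ ((StdForm.antidiagonal 2).over K)) := by rwa [pow_one]
      exact Set.disjoint_left.1 (disjoint_doubleCoset_pow_two hd ht (show (0 : ℕ) ≠ 1 by decide)) hg0 hg1
    exact ⟨u, hu, hx, by rw [hcoset, hd1, mul_one]⟩
  · -- BOTTOM CELL
    right; right
    have ha' : a = -![(1 : ℤ), -1] := by
      funext i; fin_cases i
      · exact hm1
      · simp [a1, hm1]
    have hdt : d = t⁻¹ := Subtype.ext (by rw [hdcoe, ha', coe_inv_of_coe_eq hd ht])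
    have hx2 : Valued.v (((u : GL (Fin 2) K) : Matrix (Fin 2) (Fin 2) K) 0 1) ≤ WithZero.exp (2 : ℤ) := by
      have h := hent 0 1
      rw [a1, hm1, neg_neg] at h
      have h' := hd.v_le_exp_of_mul_zpow_le h
      rwa [show (1 : ℤ) + 1 = 2 by norm_num] at h'
    have hw : t * u * t⁻¹ ∈ hd.borelLatticeU ⊓ unitaryInt σ ((StdForm.antidiagonal 2).over K) := conj_unip_mem_borelInt_two hd ht hu hx2
    rw [hcoset, hdt, eq_comm, QuotientGroup.eq]
    have h : (t⁻¹)⁻¹ * (u * t⁻¹) = t * u * t⁻¹ := by group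
    rw [h]
    exact (Subgroup.mem_inf.1 hw).2

/-! ## §7 The three cells: Iwasawa exponents, coset criteria -/

/-- **Top neighbours**: `u t K₀ = u′ t K₀` (`u, u′ ∈ K_P`) iff `u⁻¹ u′ ∈ t K_P t⁻¹`. [cite: BruhatTits1972, (4.4.4)] -/
theorem mul_coe_eq_iff_two (hd : UnramifiedLocalConjDatum σ ϖ) {t : unitaryGroupOfForm σ ((StdForm.antidiagonal 2).over K)}
    (ht : (t : GL (Fin 2) K) = zpowDiagGL (uniformizer_ne_zero hd.vϖ) ![(1 : ℤ), -1])
    {u u' : unitaryGroupOfForm σ ((StdForm.antidiagonal 2).over K)}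
    (hu : u ∈ hd.borelLatticeU ⊓ unitaryInt σ ((StdForm.antidiagonal 2).over K))
    (hu' : u' ∈ hd.borelLatticeU ⊓ unitaryInt σ ((StdForm.antidiagonal 2).over K)) :
    ((u * t : unitaryGroupOfForm σ ((StdForm.antidiagonal 2).over K)) :
        unitaryGroupOfForm σ ((StdForm.antidiagonal 2).over K) ⧸ unitaryInt σ ((StdForm.antidiagonal 2).over K)) = ↑(u' * t) ↔
      u⁻¹ * u' ∈ toConjAct t • (hd.borelLatticeU ⊓ unitaryInt σ ((StdForm.antidiagonal 2).over K)) := by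
  have hw : u⁻¹ * u' ∈ hd.borelLatticeU ⊓ unitaryInt σ ((StdForm.antidiagonal 2).over K) := Subgroup.mul_mem _ (Subgroup.inv_mem _ hu) hu'
  have hwU : ((u⁻¹ * u' : unitaryGroupOfForm σ ((StdForm.antidiagonal 2).over K)) : GL (Fin 2) K) ∈ upperUnitriangular (Fin 2) K :=
    ((hd.mem_borelLatticeU_inf_unitaryInt_iff).1 hw).1
  have hconj : t⁻¹ * (u⁻¹ * u') * t ∈ hd.borelLatticeU ⊓ unitaryInt σ ((StdForm.antidiagonal 2).over K) ↔
      t⁻¹ * (u⁻¹ * u') * t ∈ unitaryInt σ ((StdForm.antidiagonal 2).over K) := by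
    rw [hd.mem_borelLatticeU_inf_unitaryInt_iff, and_iff_right_iff_imp]
    intro _
    rw [Subgroup.coe_mul, Subgroup.coe_mul, Subgroup.coe_inv, ht]
    exact (coe_conj_mem_upperUnitriangular_iff _ _).2 hwU
  rw [QuotientGroup.eq, Subgroup.mem_pointwise_smul_iff_inv_smul_mem, ← toConjAct_inv, toConjAct_smul, inv_inv, hconj,
    show (u * t)⁻¹ * (u' * t) = t⁻¹ * (u⁻¹ * u') * t by group]

/-- The Iwasawa exponents of a top neighbour: `a(u t) = (1, −1)` (`u ∈ K_P`). [cite: BruhatTits1972, (4.4.3)] -/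
theorem iwasawaExp_mul_two (hd : UnramifiedLocalConjDatum σ ϖ) {t : unitaryGroupOfForm σ ((StdForm.antidiagonal 2).over K)}
    (ht : (t : GL (Fin 2) K) = zpowDiagGL (uniformizer_ne_zero hd.vϖ) ![(1 : ℤ), -1])
    {u : unitaryGroupOfForm σ ((StdForm.antidiagonal 2).over K)}
    (hu : u ∈ hd.borelLatticeU ⊓ unitaryInt σ ((StdForm.antidiagonal 2).over K)) : hd.iwasawaExp (u * t) = ![(1 : ℤ), -1] :=
  hd.iwasawaExp_eq (k := 1) ((hd.mem_borelLatticeU_inf_unitaryInt_iff).1 hu).1 ht (Subgroup.one_mem _) (by rw [mul_one])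

/-- The Iwasawa exponents of a level-zero neighbour: `a(u(β)) = 0`. [cite: BruhatTits1972, (4.4.3)] -/
theorem iwasawaExp_unip_two (hd : UnramifiedLocalConjDatum σ ϖ) {u : unitaryGroupOfForm σ ((StdForm.antidiagonal 2).over K)}
    (hu : (u : GL (Fin 2) K) ∈ upperUnitriangular (Fin 2) K) : hd.iwasawaExp u = 0 :=
  hd.iwasawaExp_eq (t := 1) (k := 1) hu (by rw [OneMemClass.coe_one, zpowDiagGL_zero]) (Subgroup.one_mem _) (by rw [mul_one, mul_one])

/-- The Iwasawa exponents of the bottom neighbour: `a(t⁻¹) = (−1, 1)`. [cite: BruhatTits1972, (4.4.3)] -/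
theorem iwasawaExp_inv_two (hd : UnramifiedLocalConjDatum σ ϖ) {t : unitaryGroupOfForm σ ((StdForm.antidiagonal 2).over K)}
    (ht : (t : GL (Fin 2) K) = zpowDiagGL (uniformizer_ne_zero hd.vϖ) ![(1 : ℤ), -1]) : hd.iwasawaExp t⁻¹ = -![(1 : ℤ), -1] :=
  hd.iwasawaExp_eq (u := 1) (k := 1) (by rw [OneMemClass.coe_one]; exact Subgroup.one_mem _) (coe_inv_of_coe_eq hd ht)
    (Subgroup.one_mem _) (by rw [one_mul, mul_one])

end Summit.HodgeConjecture.HodgeConjecture.Cruxes.HLiu418.K2LiuRankOneHeckeCellsTwo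

end
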